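import Summits.CriticalPhenomena.PercolationContinuityZ3.Theorems.PercNearOneGluingNoHeavyQuantTwoBlobZeroFlow
import Summits.CriticalPhenomena.PercolationContinuityZ3.Theorems.PercNearOneGluingNoHeavyQuantTopFlippedPieceCore
import Summits.CriticalPhenomena.PercolationContinuityZ3.Theorems.PercNearOneGluingNoHeavyQuantDECAtTMixtures
import Summits.CriticalPhenomena.PercolationContinuityZ3.Theorems.PercNearOneGluingNoHeavyQuantFlowUncross
import HarnessLib

/-!
# QUANT lane R8, T-DEC, (II) `ConvClosedTResidue`: THE TOP-FLIPPED PIECE IS DEC WHENEVER NEITHER RAISED RATE IS LIGHT — piece lemma P1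
# of FOR-PROVERS-CONV-PIECES §6 for all four type pairs (heavy/light ⊗ heavy/light), as a `DECAtT` statement (wrapper of `…QuantTopFlippedPieceCore`)

builds on p205010 (kernel theorem, internal audit signed; external expert review pending)

Support file (`--supports stmt-CriticalPhenomena-4575`), QUANT lane LEAD seat prim-quant-lead (gen 26), rung R8 of
`run/shared/lean/prim/quant/LADDER.md`.  Memo `run/shared/lean/prim/quant/FOR-PROVERS-CONV-PIECES.md` §4/§6, LEAD-NOTES-G26 N66/N70.
Theorems only, standard axioms, no sorries.

THE PIECE (unshifted coordinates).  The two-blob law `LAW2[A, g₁; B, g₂]` = `(1−g₁)(1−g₂)δ₀ + g₁(1−g₂)δ_A + (1−g₁)g₂δ_B + g₁g₂δ_{A+B}` at a target `S`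
and a layer `j″` with `A ≤ j″`, `B ≤ j″`, `j″ < A + B` (ONLY THE TOP CELL FLIPPED above the layer): atom `0` is the low (`0 < S`), `A` and `B` are mids
(`S ≤ 2A`, `S ≤ 2B`), `A + B` is a giant.  This is the piece `σ ⊗ τ` of a factor component `σ = {a, a+A; g₁}` and `τ = {b, b+B; g₂}` seen from the
cell `a + b` (shift by `s = a + b`: `twoBlob_topFlipped_decAtT_noLightRaise_shift`), with `S = T − 2s` the low cell's deficit.  CREDITS: `S ≤ κ₁A + κ₂B`
with `κᵢ ≤ κ_x(gᵢ) = min(gᵢ, (gᵢ − x²)/(1−x))` (the two components valid at their own targets, whose sum is at least `T`).  REGIME: `x·A ≤ S`,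
`x·B ≤ S` — the raised rates `S/A`, `S/B` of the two conv pairs out of the low cell are not light.
* `twoBlob_decAtT_of_zeroFlow_top`, `twoBlob_decAtT_of_capacity_top` — the packaging of typer g23's `…QuantTwoBlobZeroFlow` with the top cell a
  GIANT (`j″ < A + B`, usage `x/(1−x)`) instead of a mid.
* **`twoBlob_topFlipped_decAtT_noLightRaise`** — the piece is `DECAtT x S j″ (A+B)`: capacities `Cp = g₁(1−g₂)(A−S)/S` (if `S < A`, else `0`),
  `Cq = (1−g₁)g₂(B−S)/S` (if `S < B`, else `0`) at the heavy raised usages `S/(A−S)`, `S/(B−S)` (`usage0_eq_heavy`), and the giant budget from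
  `tfp_core` + `tfp_giant_budget_of_core` (lead g26 p324417), with the incompatible sub-cases by one `nlinarith` each.
* **`twoBlob_topFlipped_decAtT_noLightRaise_shift`** — shifted by `s`: target `S + 2s`, layer `j″ + s`, top `A + B + s` (`decAtT_shift_two`).
NOT COVERED (by design, FOR-PROVERS-CONV-PIECES §4): the mixed regime (one raised rate light), where the standalone piece fails from span ratio ≈ 10–25;
and the 'both raised rates light' regime of light⊗light (true with slack ≥ 0.01, separate cell).

[this work]; FOR-PROVERS-CONV-PIECES (lead g26), CONV-RESIDUE-G21 (census-1 g21), arm-2 g28's H–H cell `…QuantTwoBlobTopFlippedHeavy` (every layer,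
both gates heavy; this file adds the light gates under the regime bound).  Nothing here is cited as a published result.  The gluing rows served
[cite: KozmaNitzan2024, Conjecture 3 (p. 15)]; product measure [cite: Grimmett1999, §1.3 p. 10].
-/

noncomputable section

namespace Summit.CriticalPhenomena.PercolationContinuityZ3.Theorems

namespace Quant

open Finset

/-- the two-blob law `(1−u)(1−v)δ₀ + u(1−v)δ_a + (1−u)vδ_b + uvδ_{a+b}` evaluated at `h` (as in `…QuantBlobDecTwoLawParts`) -/
local notation3 "LAW2[" a ", " u ", " b ", " v ", " h "]" =>
  (1 - (u : ℝ)) * (1 - (v : ℝ)) * (if (h : ℕ) = 0 then (1 : ℝ) else 0)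
    + (u : ℝ) * (1 - (v : ℝ)) * (if (h : ℕ) = (a : ℕ) then (1 : ℝ) else 0)
    + (1 - (u : ℝ)) * (v : ℝ) * (if (h : ℕ) = (b : ℕ) then (1 : ℝ) else 0)
    + (u : ℝ) * (v : ℝ) * (if (h : ℕ) = (a : ℕ) + (b : ℕ) then (1 : ℝ) else 0)

namespace LawDec

/-! ### Packaging: explicit flows of atom `0` into the mids `p`, `q` and the GIANT `p + q` -/

/-- **DEC OF THE TWO-BLOB LAW WITH ONLY ATOM `0` LOW AND THE TOP CELL A GIANT, FROM AN EXPLICIT FLOW** into `p`, `q` (mids `≤ j″`) and `p+q`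
(`> j″`, usage `x/(1−x)`).  The giant-top twin of `twoBlob_decAtT_of_zeroFlow`. [this work] -/
theorem twoBlob_decAtT_of_zeroFlow_top (x u v T Fp Fq Fs : ℝ) (p q j'' : ℕ) (hx0 : 0 < x) (hx1 : x < 1) (hu0 : 0 ≤ u) (hu1 : u ≤ 1)
    (hv0 : 0 ≤ v) (hv1 : v ≤ 1) (hp : 1 ≤ p) (hq : 1 ≤ q) (hpj : p ≤ j'') (hqj : q ≤ j'') (hjs : j'' < p + q) (hT0 : 0 < T)
    (hTp : T ≤ 2 * (p : ℝ)) (hTq : T ≤ 2 * (q : ℝ))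
    (hFp0 : 0 ≤ Fp) (hFq0 : 0 ≤ Fq) (hFs0 : 0 ≤ Fs) (hsum : Fp + Fq + Fs = (1 - u) * (1 - v))
    (hFp : 0 < Fp → T < (p : ℝ) ∧ usage x T j'' 0 p * Fp ≤ u * (1 - v))
    (hFq : 0 < Fq → T < (q : ℝ) ∧ usage x T j'' 0 q * Fq ≤ (1 - u) * v)
    (hFs : x / (1 - x) * Fs ≤ u * v) :
    DECAtT x T j'' (p + q) (fun h => LAW2[p, u, q, v, h]) := by
  classical
  set f : ℕ → ℕ → ℝ := fun l h =>
    (Fp * (if h = p then (1:ℝ) else 0) + Fq * (if h = q then (1:ℝ) else 0) + Fs * (if h = p + q then (1:ℝ) else 0))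
      * (if l = 0 then (1:ℝ) else 0) with hf
  have ind_nn : ∀ (P : Prop) [Decidable P], (0:ℝ) ≤ (if P then (1:ℝ) else 0) := fun P _ => by split_ifs <;> norm_num
  have hus : usage x T j'' 0 (p + q) = x / (1 - x) := usage_giant_eq x T j'' 0 (p + q) (by omega)
  refine decAtT_of_flowAtT x T j'' (p + q) _ hx0 hx1 (fun h hh => BlobDec2.law_eq_zero_of_lt p q u v h hh)
    (BlobDec2.law_mass p q u v) ⟨f, ?_, ?_, ?_, ?_⟩
  · intro l h
    simp only [hf]
    refine mul_nonneg ?_ (ind_nn _)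
    have := mul_nonneg hFp0 (ind_nn (h = p)); have := mul_nonneg hFq0 (ind_nn (h = q))
    have := mul_nonneg hFs0 (ind_nn (h = p + q))
    linarith
  · -- support: (0, p) [Fp > 0], (0, q) [Fq > 0], (0, p+q) [giant]
    intro l h hpos
    simp only [hf] at hpos
    by_cases hl0 : l = 0
    · rw [if_pos hl0, mul_one] at hpos
      by_cases hhs : h = p + q
      · exact ⟨by omega, by rw [hl0]; simpa using hT0, by omega, Or.inl (by omega)⟩
      · rw [if_neg hhs, mul_zero, add_zero] at hpos
        have key : T < (h : ℝ) ∧ h ≤ p + q := by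
          by_cases hh : h = p
          · rw [hh]
            refine ⟨?_, by omega⟩
            by_contra hcon
            have e1 : Fp = 0 := by
              by_contra hne
              exact hcon (hFp (lt_of_le_of_ne hFp0 (Ne.symm hne))).1
            rw [if_pos hh, e1] at hpos
            by_cases hhq : h = q
            · rw [if_pos hhq] at hpos
              have hFqpos : 0 < Fq := by linarith
              have := (hFq hFqpos).1
              rw [← hhq, hh] at this
              exact hcon this
            · rw [if_neg hhq] at hpos
              linarith
          · rw [if_neg hh, mul_zero, zero_add] at hpos
            by_cases hhq : h = q
            · rw [if_pos hhq, mul_one] at hpos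
              rw [hhq]
              exact ⟨(hFq hpos).1, by omega⟩
            · rw [if_neg hhq, mul_zero] at hpos; exact absurd hpos (lt_irrefl 0)
        refine ⟨by omega, by rw [hl0]; simpa using hT0, key.2, Or.inr ?_⟩
        rw [hl0]; push_cast; linarith [key.1]
    · rw [if_neg hl0, mul_zero] at hpos; exact absurd hpos (lt_irrefl 0)
  · -- the only low atom is 0
    intro l hlj hlow
    have hsum' : ∑ h ∈ Finset.range (p + q + 1), f l h
        = (Fp + Fq + Fs) * (if l = 0 then (1:ℝ) else 0) := by
      have e : ∀ h, f l h = (if l = 0 then (1:ℝ) else 0) * Fp * (if h = p then (1:ℝ) else 0)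
          + (if l = 0 then (1:ℝ) else 0) * Fq * (if h = q then (1:ℝ) else 0)
          + (if l = 0 then (1:ℝ) else 0) * Fs * (if h = p + q then (1:ℝ) else 0) := fun h => by simp only [hf]; ring
      simp only [e, Finset.sum_add_distrib]
      rw [BlobDec2.sum_range_const_indicator _ p (by omega), BlobDec2.sum_range_const_indicator _ q (by omega),
        BlobDec2.sum_range_const_indicator _ (p + q) le_rfl]
      ring
    rw [hsum', hsum]
    dsimp only
    have hlp : l ≠ p := by rintro rfl; linarith
    have hlq : l ≠ q := by rintro rfl; linarith
    have hlpq : l ≠ p + q := by rintro rfl; push_cast at hlow; linarith [(Nat.cast_nonneg p : (0:ℝ) ≤ p)]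
    by_cases hl0 : l = 0
    · rw [if_pos hl0, if_neg hlp, if_neg hlq, if_neg hlpq]; ring
    · rw [if_neg hl0, if_neg hlp, if_neg hlq, if_neg hlpq]; ring
  · -- absorbers
    intro h hhM hself
    have hsum' : ∑ l ∈ Finset.range (j'' + 1), usage x T j'' l h * f l h
        = usage x T j'' 0 h * (Fp * (if h = p then (1:ℝ) else 0) + Fq * (if h = q then (1:ℝ) else 0)
            + Fs * (if h = p + q then (1:ℝ) else 0)) := by
      have e : ∀ l, usage x T j'' l h * f l h
          = (usage x T j'' 0 h * (Fp * (if h = p then (1:ℝ) else 0) + Fq * (if h = q then (1:ℝ) else 0)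
            + Fs * (if h = p + q then (1:ℝ) else 0))) * (if l = 0 then (1:ℝ) else 0) := by
        intro l; simp only [hf]
        by_cases hl0 : l = 0
        · rw [if_pos hl0, hl0]; ring
        · rw [if_neg hl0]; ring
      simp only [e]
      rw [BlobDec2.sum_range_const_indicator _ 0 (Nat.zero_le _)]
    rw [hsum']
    dsimp only
    have hh0 : h ≠ 0 := by
      rintro rfl
      rcases hself with h1 | h1
      · omega
      · simp at h1; linarith
    have hmp : 0 ≤ u * (1 - v) := mul_nonneg hu0 (by linarith)
    have hmq : 0 ≤ (1 - u) * v := mul_nonneg (by linarith) hv0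
    have hms : 0 ≤ u * v := mul_nonneg hu0 hv0
    have hFp' : usage x T j'' 0 p * Fp ≤ u * (1 - v) := by
      rcases hFp0.eq_or_lt with hz | hpos
      · rw [← hz, mul_zero]; exact hmp
      · exact (hFp hpos).2
    have hFq' : usage x T j'' 0 q * Fq ≤ (1 - u) * v := by
      rcases hFq0.eq_or_lt with hz | hpos
      · rw [← hz, mul_zero]; exact hmq
      · exact (hFq hpos).2
    have hFs' : usage x T j'' 0 (p + q) * Fs ≤ u * v := by rw [hus]; exact hFs
    rw [if_neg hh0]
    by_cases hhp : h = p
    · rw [if_pos hhp]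
      by_cases hhq : h = q
      · -- p = q: the atom carries both masses
        rw [if_pos hhq, if_neg (show h ≠ p + q by omega)]
        simp only [mul_one, mul_zero, add_zero, zero_add]
        rw [mul_add]
        have e1 : usage x T j'' 0 h = usage x T j'' 0 p := by rw [hhp]
        have e2 : usage x T j'' 0 h = usage x T j'' 0 q := by rw [hhq]
        nlinarith [hFp', hFq', e1, e2, mul_nonneg (sub_nonneg.2 hu1) (sub_nonneg.2 hv1), ind_nn (h = 0)]
      · rw [if_neg hhq, if_neg (show h ≠ p + q by omega)]
        simp only [mul_one, mul_zero, add_zero]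
        rw [hhp]; linarith [hFp']
    · rw [if_neg hhp]
      by_cases hhq : h = q
      · rw [if_pos hhq, if_neg (show h ≠ p + q by omega)]
        simp only [mul_one, mul_zero, add_zero, zero_add]
        rw [hhq]; linarith [hFq']
      · rw [if_neg hhq]
        by_cases hhs : h = p + q
        · rw [if_pos hhs]
          simp only [mul_one, mul_zero, zero_add]
          rw [hhs]; linarith [hFs']
        · rw [if_neg hhs]
          simp only [mul_zero, add_zero]
          rfl

/-- **DEC OF THE TWO-BLOB LAW WITH ONLY ATOM `0` LOW AND A GIANT TOP, FROM THE CAPACITY INEQUALITY**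
`(1−u)(1−v) ≤ Cp + Cq + uv·(1−x)/x` (flows proportional to the capacities).  Twin of `twoBlob_decAtT_of_capacity`. [this work] -/
theorem twoBlob_decAtT_of_capacity_top (x u v T Cp Cq : ℝ) (p q j'' : ℕ) (hx0 : 0 < x) (hx1 : x < 1) (hu0 : 0 ≤ u) (hu1 : u ≤ 1)
    (hv0 : 0 ≤ v) (hv1 : v ≤ 1) (hp : 1 ≤ p) (hq : 1 ≤ q) (hpj : p ≤ j'') (hqj : q ≤ j'') (hjs : j'' < p + q) (hT0 : 0 < T)
    (hTp : T ≤ 2 * (p : ℝ)) (hTq : T ≤ 2 * (q : ℝ)) (hCp0 : 0 ≤ Cp) (hCq0 : 0 ≤ Cq)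
    (hCp : Cp = 0 ∨ (T < (p : ℝ) ∧ Cp * usage x T j'' 0 p ≤ u * (1 - v)))
    (hCq : Cq = 0 ∨ (T < (q : ℝ) ∧ Cq * usage x T j'' 0 q ≤ (1 - u) * v))
    (hcap : (1 - u) * (1 - v) ≤ Cp + Cq + u * v * ((1 - x) / x)) :
    DECAtT x T j'' (p + q) (fun h => LAW2[p, u, q, v, h]) := by
  have h1x : 0 < 1 - x := by linarith
  set Cs : ℝ := u * v * ((1 - x) / x) with hCs
  have hCs0 : 0 ≤ Cs := mul_nonneg (mul_nonneg hu0 hv0) (div_nonneg h1x.le hx0.le)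
  set C : ℝ := Cp + Cq + Cs with hC
  set m0 : ℝ := (1 - u) * (1 - v) with hm0
  have hm00 : 0 ≤ m0 := mul_nonneg (by linarith) (by linarith)
  -- usage of a compatible mid for atom 0 is nonnegative
  have hug : ∀ (r : ℕ), 1 ≤ r → r ≤ j'' → T < (r : ℝ) → 0 ≤ usage x T j'' 0 r := by
    intro r hr hrj hTr
    have h0 := pairGate_pos x T 0 r (by simpa using hT0) (by omega)
    have h1 := pairGate_lt_one x T 0 r hx0 hx1 (by simpa using hT0) (by simpa using hTr)
    simp only [usage, gateOf, if_neg (show ¬ (j'' + 1 ≤ r) by omega)]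
    exact div_nonneg h0.le (by linarith)
  rcases hm00.eq_or_lt with hz | hm0pos
  · -- no low mass at all: the zero flow
    refine twoBlob_decAtT_of_zeroFlow_top x u v T 0 0 0 p q j'' hx0 hx1 hu0 hu1 hv0 hv1 hp hq hpj hqj hjs hT0 hTp hTq le_rfl le_rfl
      le_rfl (by rw [← hm0, ← hz]; ring) (fun h => absurd h (lt_irrefl 0)) (fun h => absurd h (lt_irrefl 0)) ?_
    rw [mul_zero]; exact mul_nonneg hu0 hv0
  have hCpos : 0 < C := lt_of_lt_of_le hm0pos hcap
  have hratio : m0 / C ≤ 1 := by rw [div_le_one hCpos]; exact hcap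
  have hratio0 : 0 ≤ m0 / C := div_nonneg hm00 hCpos.le
  refine twoBlob_decAtT_of_zeroFlow_top x u v T (m0 / C * Cp) (m0 / C * Cq) (m0 / C * Cs) p q j'' hx0 hx1 hu0 hu1 hv0 hv1 hp hq
    hpj hqj hjs hT0 hTp hTq (mul_nonneg hratio0 hCp0) (mul_nonneg hratio0 hCq0) (mul_nonneg hratio0 hCs0) ?_ ?_ ?_ ?_
  · rw [← mul_add, ← mul_add, ← hC, div_mul_cancel₀ _ hCpos.ne']
  · intro hpos
    rcases hCp with hz | ⟨hTp', hle⟩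
    · rw [hz, mul_zero] at hpos; exact absurd hpos (lt_irrefl 0)
    · refine ⟨hTp', ?_⟩
      calc usage x T j'' 0 p * (m0 / C * Cp) = (m0 / C) * (Cp * usage x T j'' 0 p) := by ring
        _ ≤ 1 * (u * (1 - v)) := mul_le_mul hratio hle (mul_nonneg hCp0 (hug p hp hpj hTp')) zero_le_one
        _ = u * (1 - v) := one_mul _
  · intro hpos
    rcases hCq with hz | ⟨hTq', hle⟩
    · rw [hz, mul_zero] at hpos; exact absurd hpos (lt_irrefl 0)
    · refine ⟨hTq', ?_⟩
      calc usage x T j'' 0 q * (m0 / C * Cq) = (m0 / C) * (Cq * usage x T j'' 0 q) := by ring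
        _ ≤ 1 * ((1 - u) * v) := mul_le_mul hratio hle (mul_nonneg hCq0 (hug q hq hqj hTq')) zero_le_one
        _ = (1 - u) * v := one_mul _
  · calc x / (1 - x) * (m0 / C * Cs) = (m0 / C) * (u * v) := by
          rw [hCs]; field_simp
      _ ≤ 1 * (u * v) := mul_le_mul_of_nonneg_right hratio (mul_nonneg hu0 hv0)
      _ = u * v := one_mul _

/-! ### The top-flipped piece under the no-light-raised-rate regime -/

/-- **THE TOP-FLIPPED PIECE IS DEC WHENEVER NEITHER RAISED RATE IS LIGHT** (unshifted coordinates; statement in the file header).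
Capacities at the heavy raised usages `S/(A−S)`, `S/(B−S)` (`usage0_eq_heavy`; dropped when the raised pair is incompatible, `A ≤ S` / `B ≤ S`),
giant budget by `tfp_core` + `tfp_giant_budget_of_core` (p324417). [this work] -/
theorem twoBlob_topFlipped_decAtT_noLightRaise (x g₁ g₂ κ₁ κ₂ S : ℝ) (A B j'' : ℕ) (hx0 : 0 < x) (hx1 : x < 1)
    (hg₁ : x ^ 2 ≤ g₁) (hg₁1 : g₁ ≤ 1) (hg₂ : x ^ 2 ≤ g₂) (hg₂1 : g₂ ≤ 1)
    (hκ₁ : κ₁ ≤ g₁) (hκ₁' : (1 - x) * κ₁ ≤ g₁ - x ^ 2) (hκ₂ : κ₂ ≤ g₂) (hκ₂' : (1 - x) * κ₂ ≤ g₂ - x ^ 2)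
    (hA : 1 ≤ A) (hB : 1 ≤ B) (hAj : A ≤ j'') (hBj : B ≤ j'') (hjs : j'' < A + B)
    (hS0 : 0 < S) (hcred : S ≤ κ₁ * A + κ₂ * B) (hSA : S ≤ 2 * (A : ℝ)) (hSB : S ≤ 2 * (B : ℝ))
    (hregA : x * A ≤ S) (hregB : x * B ≤ S) :
    DECAtT x S j'' (A + B) (fun h => LAW2[A, g₁, B, g₂, h]) := by
  have h1x : 0 < 1 - x := by linarith
  have hg₁0 : 0 ≤ g₁ := le_trans (sq_nonneg x) hg₁
  have hg₂0 : 0 ≤ g₂ := le_trans (sq_nonneg x) hg₂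
  have hA0 : (0 : ℝ) ≤ A := by positivity
  have hB0 : (0 : ℝ) ≤ B := by positivity
  -- the core inequality
  have hcore := tfp_core x g₁ g₂ κ₁ κ₂ S A B hx0 hx1 hg₁ hg₁1 hg₂ hg₂1 hκ₁ hκ₁' hκ₂ hκ₂' hA0 hB0 hS0.le hcred hregA hregB
  -- capacities
  set Cp : ℝ := if S < (A : ℝ) then g₁ * (1 - g₂) * ((A : ℝ) - S) / S else 0 with hCp
  set Cq : ℝ := if S < (B : ℝ) then (1 - g₁) * g₂ * ((B : ℝ) - S) / S else 0 with hCq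
  have hCp0 : 0 ≤ Cp := by
    simp only [hCp]; split_ifs with h
    · exact div_nonneg (mul_nonneg (mul_nonneg hg₁0 (by linarith)) (by linarith)) hS0.le
    · exact le_rfl
  have hCq0 : 0 ≤ Cq := by
    simp only [hCq]; split_ifs with h
    · exact div_nonneg (mul_nonneg (mul_nonneg (by linarith) hg₂0) (by linarith)) hS0.le
    · exact le_rfl
  refine twoBlob_decAtT_of_capacity_top x g₁ g₂ S Cp Cq A B j'' hx0 hx1 hg₁0 hg₁1 hg₂0 hg₂1 hA hB hAj hBj hjs hS0 hSA hSB hCp0 hCq0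
    ?_ ?_ ?_
  · -- the p-capacity loads the mid A by exactly its mass
    by_cases h : S < (A : ℝ)
    · right
      refine ⟨h, ?_⟩
      have hu : usage x S j'' 0 A = S / ((A : ℝ) - S) := usage0_eq_heavy x S j'' A hx0 hx1 hAj hS0 h hregA
      simp only [hCp, if_pos h]
      rw [hu]
      have hAS : 0 < (A : ℝ) - S := by linarith
      rw [div_mul_div_comm, div_le_iff₀ (mul_pos hS0 hAS)]
      nlinarith [mul_nonneg hg₁0 (sub_nonneg.2 hg₂1)]
    · left; simp only [hCp, if_neg h]
  · by_cases h : S < (B : ℝ)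
    · right
      refine ⟨h, ?_⟩
      have hu : usage x S j'' 0 B = S / ((B : ℝ) - S) := usage0_eq_heavy x S j'' B hx0 hx1 hBj hS0 h hregB
      simp only [hCq, if_pos h]
      rw [hu]
      have hBS : 0 < (B : ℝ) - S := by linarith
      rw [div_mul_div_comm, div_le_iff₀ (mul_pos hS0 hBS)]
      nlinarith [mul_nonneg (sub_nonneg.2 hg₁1) hg₂0]
    · left; simp only [hCq, if_neg h]
  · -- the giant budget, four sub-cases (each raised pair compatible or not)
    have goal_of : ∀ R : ℝ, x / (1 - x) * ((1 - g₁) * (1 - g₂) - R) ≤ g₁ * g₂ → R ≤ Cp + Cq →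
        (1 - g₁) * (1 - g₂) ≤ Cp + Cq + g₁ * g₂ * ((1 - x) / x) := by
      intro R hR hRC
      rw [div_mul_eq_mul_div, div_le_iff₀ h1x] at hR
      have : (1 - g₁) * (1 - g₂) - R ≤ g₁ * g₂ * ((1 - x) / x) := by
        rw [← mul_div_assoc, le_div_iff₀ hx0]; linarith
      linarith
    by_cases hpA : S < (A : ℝ)
    · by_cases hqB : S < (B : ℝ)
      · refine goal_of (g₁ * (1 - g₂) * ((A : ℝ) - S) / S + (1 - g₁) * g₂ * ((B : ℝ) - S) / S) ?_ ?_
        · have := tfp_giant_budget_of_core x g₁ g₂ S A B hx1 hS0 hcore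
          have e : (1 - g₁) * (1 - g₂) - (g₁ * (1 - g₂) * ((A : ℝ) - S) / S + (1 - g₁) * g₂ * ((B : ℝ) - S) / S)
              = (1 - g₁) * (1 - g₂) - g₁ * (1 - g₂) * ((A : ℝ) - S) / S - (1 - g₁) * g₂ * ((B : ℝ) - S) / S := by ring
          rw [e]; exact this
        · simp only [hCp, hCq, if_pos hpA, if_pos hqB]; exact le_rfl
      · refine goal_of (g₁ * (1 - g₂) * ((A : ℝ) - S) / S) ?_ ?_
        · exact tfp_giant_budget_dropE x g₁ g₂ S A B hx0.le hx1 hS0 hg₂0 hg₁1 (not_lt.1 hqB) hcore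
        · simp only [hCp, hCq, if_pos hpA, if_neg hqB, add_zero]; exact le_rfl
    · by_cases hqB : S < (B : ℝ)
      · refine goal_of ((1 - g₁) * g₂ * ((B : ℝ) - S) / S) ?_ ?_
        · exact tfp_giant_budget_dropD x g₁ g₂ S A B hx0.le hx1 hS0 hg₁0 hg₂1 (not_lt.1 hpA) hcore
        · simp only [hCp, hCq, if_neg hpA, if_pos hqB, zero_add]; exact le_rfl
      · refine goal_of 0 ?_ ?_
        · rw [sub_zero]
          exact tfp_giant_budget_dropDE x g₁ g₂ S A B hx0.le hx1 hS0 hg₁0 hg₁1 hg₂0 hg₂1 (not_lt.1 hpA) (not_lt.1 hqB) hcore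
        · simp only [hCp, hCq, if_neg hpA, if_neg hqB, add_zero]; exact le_rfl

/-- **THE TOP-FLIPPED PIECE IN CELL COORDINATES (shift by `s = a + b`)**: target `S + 2s`, layer `j″ + s`, top `A + B + s`. [this work] -/
theorem twoBlob_topFlipped_decAtT_noLightRaise_shift (x g₁ g₂ κ₁ κ₂ S : ℝ) (A B j'' s : ℕ) (hx0 : 0 < x) (hx1 : x < 1)
    (hg₁ : x ^ 2 ≤ g₁) (hg₁1 : g₁ ≤ 1) (hg₂ : x ^ 2 ≤ g₂) (hg₂1 : g₂ ≤ 1)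
    (hκ₁ : κ₁ ≤ g₁) (hκ₁' : (1 - x) * κ₁ ≤ g₁ - x ^ 2) (hκ₂ : κ₂ ≤ g₂) (hκ₂' : (1 - x) * κ₂ ≤ g₂ - x ^ 2)
    (hA : 1 ≤ A) (hB : 1 ≤ B) (hAj : A ≤ j'') (hBj : B ≤ j'') (hjs : j'' < A + B)
    (hS0 : 0 < S) (hcred : S ≤ κ₁ * A + κ₂ * B) (hSA : S ≤ 2 * (A : ℝ)) (hSB : S ≤ 2 * (B : ℝ))
    (hregA : x * A ≤ S) (hregB : x * B ≤ S) :
    DECAtT x (S + 2 * (s : ℝ)) (j'' + s) (A + B + s) (fun h => if s ≤ h then LAW2[A, g₁, B, g₂, h - s] else 0) :=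
  decAtT_shift_two x S j'' (A + B) s _ (twoBlob_topFlipped_decAtT_noLightRaise x g₁ g₂ κ₁ κ₂ S A B j'' hx0 hx1 hg₁ hg₁1 hg₂
    hg₂1 hκ₁ hκ₁' hκ₂ hκ₂' hA hB hAj hBj hjs hS0 hcred hSA hSB hregA hregB)

end LawDec

end Quant

end Summit.CriticalPhenomena.PercolationContinuityZ3.Theorems
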